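import Mathlib

/-!
# Route `BECGroundStateSOS`, crux `LatticeODLROOffHalfFilling` (stmt-AtomisticToContinuum-11033),
# line `Sketch`: the registered stub `stub_tent`

Supports (does not close) stmt-AtomisticToContinuum-11033. Pure real analysis: a finitely supported
sequence `a : ℕ → ℝ` which is (midpoint) concave on `[0, V]`
(`a (n+1) + a (n-1) ≤ 2 a n` for `1 ≤ n ≤ V-1`) and nonnegative on `[0, V]` lies above the tent
through any anchor `(N', a N')`, `0 < N' < V`:
`a N ≥ a N' · min (N/N', (V-N)/(V-N'))` for every `N ≤ V`.

Proof: the forward differences `a (n+1) - a n` are non-increasing on `0 ≤ n ≤ V-1`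
(`tent_fd_antitone`), whence the one-sided mean-increment bounds `(j-i)(a (j+1) - a j) ≤ a j - a i`
(`tent_lower_sum`) and `a k - a j ≤ (k-j)(a (j+1) - a j)` (`tent_upper_sum`), and the three-point
chord inequality `(k-j) a i + (j-i) a k ≤ (k-i) a j` for `i ≤ j ≤ k ≤ V` (`tent_three_point`).
The tent bound is the chord inequality on `[0, N']` (dropping `a 0 ≥ 0`) for `N ≤ N'` and on
`[N', V]` (dropping `a V ≥ 0`) for `N' ≤ N`.
-/

namespace Summit.AtomisticToContinuum.BoseEinsteinCondensation.Theorems.LatticeODLROOffHalfFilling.Ladder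

/-- One step of monotonicity of forward differences of a midpoint-concave sequence:
`a (m+2) - a (m+1) ≤ a (m+1) - a m` for `m + 2 ≤ V`. [folklore] -/
private theorem tent_fd_step (V : ℕ) (a : ℕ → ℝ)
    (hconc : ∀ n : ℕ, 1 ≤ n → n + 1 ≤ V → a (n + 1) + a (n - 1) ≤ 2 * a n)
    (m : ℕ) (hm : m + 2 ≤ V) : a (m + 2) - a (m + 1) ≤ a (m + 1) - a m := by
  have h := hconc (m + 1) (by omega) (by omega)
  have e1 : m + 1 + 1 = m + 2 := by omega
  have e2 : m + 1 - 1 = m := by omega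
  rw [e1, e2] at h
  linarith

/-- Forward differences of a midpoint-concave sequence are non-increasing on `[0, V-1]`:
`a (p+t+1) - a (p+t) ≤ a (p+1) - a p` for `p + t + 1 ≤ V`. [folklore] -/
private theorem tent_fd_antitone (V : ℕ) (a : ℕ → ℝ)
    (hconc : ∀ n : ℕ, 1 ≤ n → n + 1 ≤ V → a (n + 1) + a (n - 1) ≤ 2 * a n)
    (p t : ℕ) (h : p + t + 1 ≤ V) : a (p + t + 1) - a (p + t) ≤ a (p + 1) - a p := by
  induction t with
  | zero => simp
  | succ t ih =>
    have h1 := tent_fd_step V a hconc (p + t) (by omega)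
    have h2 := ih (by omega)
    have e1 : p + (t + 1) + 1 = p + t + 2 := by omega
    have e2 : p + (t + 1) = p + t + 1 := by omega
    rw [e1, e2]
    linarith

/-- Lower mean-increment bound for a midpoint-concave sequence:
`t · (a (i+t+1) - a (i+t)) ≤ a (i+t) - a i` for `i + t + 1 ≤ V`. [folklore] -/
private theorem tent_lower_sum (V : ℕ) (a : ℕ → ℝ)
    (hconc : ∀ n : ℕ, 1 ≤ n → n + 1 ≤ V → a (n + 1) + a (n - 1) ≤ 2 * a n)
    (i t : ℕ) (h : i + t + 1 ≤ V) : (t : ℝ) * (a (i + t + 1) - a (i + t)) ≤ a (i + t) - a i := by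
  induction t with
  | zero => simp
  | succ t ih =>
    have h1 := tent_fd_step V a hconc (i + t) (by omega)
    have h2 := ih (by omega)
    have h3 := mul_le_mul_of_nonneg_left h1 (by positivity : (0 : ℝ) ≤ (t : ℝ) + 1)
    have e1 : i + (t + 1) + 1 = i + t + 2 := by omega
    have e2 : i + (t + 1) = i + t + 1 := by omega
    rw [e1, e2]
    push_cast
    linarith

/-- Upper mean-increment bound for a midpoint-concave sequence:
`a (j+t) - a j ≤ t · (a (j+1) - a j)` for `j + t ≤ V`. [folklore] -/
private theorem tent_upper_sum (V : ℕ) (a : ℕ → ℝ)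
    (hconc : ∀ n : ℕ, 1 ≤ n → n + 1 ≤ V → a (n + 1) + a (n - 1) ≤ 2 * a n)
    (j t : ℕ) (h : j + t ≤ V) : a (j + t) - a j ≤ (t : ℝ) * (a (j + 1) - a j) := by
  induction t with
  | zero => simp
  | succ t ih =>
    have h1 := tent_fd_antitone V a hconc j t (by omega)
    have h2 := ih (by omega)
    have e2 : j + (t + 1) = j + t + 1 := by omega
    rw [e2]
    push_cast
    linarith

/-- Three-point chord inequality for a midpoint-concave sequence on `[0, V]`:
`(k-j) a i + (j-i) a k ≤ (k-i) a j` for `i ≤ j ≤ k ≤ V`. [folklore] -/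
private theorem tent_three_point (V : ℕ) (a : ℕ → ℝ)
    (hconc : ∀ n : ℕ, 1 ≤ n → n + 1 ≤ V → a (n + 1) + a (n - 1) ≤ 2 * a n)
    (i j k : ℕ) (hij : i ≤ j) (hjk : j ≤ k) (hkV : k ≤ V) :
    ((k : ℝ) - j) * a i + ((j : ℝ) - i) * a k ≤ ((k : ℝ) - i) * a j := by
  obtain ⟨t₁, rfl⟩ := Nat.exists_eq_add_of_le hij
  obtain ⟨t₂, rfl⟩ := Nat.exists_eq_add_of_le hjk
  rcases Nat.eq_zero_or_pos t₂ with h0 | _hpos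
  · subst h0
    simp only [add_zero]
    push_cast
    linarith
  · have hlow := tent_lower_sum V a hconc i t₁ (by omega)
    have hup := tent_upper_sum V a hconc (i + t₁) t₂ (by omega)
    have h3 := mul_le_mul_of_nonneg_left hlow (by positivity : (0 : ℝ) ≤ (t₂ : ℝ))
    have h4 := mul_le_mul_of_nonneg_left hup (by positivity : (0 : ℝ) ≤ (t₁ : ℝ))
    push_cast
    nlinarith [h3, h4]

/-- **Tent bound for concave nonnegative sequences.** If `a` is concave on `[1, V−1]` and
nonnegative on `[0, V]`, then `a N ≥ a N' · min (N/N', (V−N)/(V−N'))` for `0 < N' < V`, `N ≤ V`.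
[folklore] -/
theorem stub_tent (V : ℕ) (a : ℕ → ℝ)
    (hconc : ∀ n : ℕ, 1 ≤ n → n + 1 ≤ V → a (n + 1) + a (n - 1) ≤ 2 * a n)
    (hnn : ∀ n : ℕ, n ≤ V → 0 ≤ a n) (N N' : ℕ) (hN'0 : 0 < N') (hN'V : N' < V) (hNV : N ≤ V) :
    a N' * min ((N : ℝ) / N') (((V : ℝ) - N) / ((V : ℝ) - N')) ≤ a N := by
  have haN' : 0 ≤ a N' := hnn N' hN'V.le
  rcases le_or_gt N N' with hle | hlt
  · -- chord inequality on `[0, N']`, dropping the nonnegative term `(N' - N) a 0`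
    have h3 := tent_three_point V a hconc 0 N N' (Nat.zero_le N) hle hN'V.le
    have ha0 : 0 ≤ a 0 := hnn 0 (Nat.zero_le V)
    have hcoef : (0 : ℝ) ≤ (N' : ℝ) - N := by
      have : (N : ℝ) ≤ N' := by exact_mod_cast hle
      linarith
    have hprod : 0 ≤ ((N' : ℝ) - N) * a 0 := mul_nonneg hcoef ha0
    have hN'pos : (0 : ℝ) < N' := by exact_mod_cast hN'0
    have hkey : (N : ℝ) * a N' ≤ (N' : ℝ) * a N := by
      push_cast at h3
      linarith
    calc a N' * min ((N : ℝ) / N') (((V : ℝ) - N) / ((V : ℝ) - N'))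
        ≤ a N' * ((N : ℝ) / N') := mul_le_mul_of_nonneg_left (min_le_left _ _) haN'
      _ = (N : ℝ) * a N' / N' := by ring
      _ ≤ a N := by
          rw [div_le_iff₀ hN'pos]
          linarith
  · -- chord inequality on `[N', V]`, dropping the nonnegative term `(N - N') a V`
    have h3 := tent_three_point V a hconc N' N V hlt.le hNV le_rfl
    have haV : 0 ≤ a V := hnn V le_rfl
    have hcoef : (0 : ℝ) ≤ (N : ℝ) - N' := by
      have : (N' : ℝ) ≤ N := by exact_mod_cast hlt.le
      linarith
    have hprod : 0 ≤ ((N : ℝ) - N') * a V := mul_nonneg hcoef haV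
    have hVpos : (0 : ℝ) < (V : ℝ) - N' := by
      have : (N' : ℝ) < V := by exact_mod_cast hN'V
      linarith
    have hkey : ((V : ℝ) - N) * a N' ≤ ((V : ℝ) - N') * a N := by linarith
    calc a N' * min ((N : ℝ) / N') (((V : ℝ) - N) / ((V : ℝ) - N'))
        ≤ a N' * (((V : ℝ) - N) / ((V : ℝ) - N')) :=
          mul_le_mul_of_nonneg_left (min_le_right _ _) haN'
      _ = ((V : ℝ) - N) * a N' / ((V : ℝ) - N') := by ring
      _ ≤ a N := by
          rw [div_le_iff₀ hVpos]
          linarith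

end Summit.AtomisticToContinuum.BoseEinsteinCondensation.Theorems.LatticeODLROOffHalfFilling.Ladder
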